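import Mathlib.Probability.ProductMeasure

/-!
# Invariance of an i.i.d. product measure under a partial reindexing transform

Helper for crux stmt-CriticalPhenomena-7029
(`Summit.CriticalPhenomena.CardyFormulaZ2.Theses.CardyFlipRusso.QuadrupoleSelectionRule`),
line Sketch, stub S2.

The abstract measure-theoretic statement behind the "partial rotation" lever: an i.i.d. product
measure `Measure.infinitePi (fun _ : ι => μ)` is invariant under the map
`ξ ↦ (i ↦ f i (ξ (e.symm i)))`, i.e. reindexing by a bijection `e : ι ≃ ι` followed by
coordinatewise measurable maps `f i`, each of which preserves the site law `μ`.

The proof factors the map as `(fun x i ↦ f i (x i)) ∘ MeasurableEquiv.piCongrLeft (fun _ ↦ α) e`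
and uses Mathlib's `Measure.infinitePi_map_piCongrLeft` and `Measure.infinitePi_map_pi`.
-/

namespace Summit.CriticalPhenomena.CardyFormulaZ2.Theorems

open MeasureTheory

/-- An i.i.d. product measure (constant family of a probability measure `μ`) is invariant under
reindexing by a bijection `e` of the index set followed by coordinatewise measurable maps `f i`
each preserving `μ`: the push-forward of `infinitePi (fun _ ↦ μ)` under
`ξ ↦ (i ↦ f i (ξ (e.symm i)))` is again `infinitePi (fun _ ↦ μ)`. [folklore] -/
theorem infinitePi_map_partialTransform {ι α : Type*} [MeasurableSpace α]
    (μ : Measure α) [IsProbabilityMeasure μ] (e : ι ≃ ι) (f : ι → α → α)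
    (hf : ∀ i, Measurable (f i)) (hμ : ∀ i, μ.map (f i) = μ) :
    (Measure.infinitePi (fun _ : ι => μ)).map (fun ξ i => f i (ξ (e.symm i)))
      = Measure.infinitePi (fun _ : ι => μ) := by
  have h1 : (fun (ξ : ι → α) (i : ι) => f i (ξ (e.symm i))) =
      (fun (x : ι → α) (i : ι) => f i (x i)) ∘
        ⇑(MeasurableEquiv.piCongrLeft (fun _ : ι => α) e) := by
    funext ξ; funext i
    simp only [Function.comp_apply, MeasurableEquiv.coe_piCongrLeft,
      Equiv.piCongrLeft_apply_eq_cast, cast_eq]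
  have h2 : Measure.map (⇑(MeasurableEquiv.piCongrLeft (fun _ : ι => α) e))
      (Measure.infinitePi (fun _ : ι => μ)) = Measure.infinitePi (fun _ : ι => μ) :=
    Measure.infinitePi_map_piCongrLeft (fun _ : ι => μ) e
  have h3 : Measure.map (fun (x : ι → α) (i : ι) => f i (x i))
      (Measure.infinitePi (fun _ : ι => μ)) = Measure.infinitePi fun i : ι => μ.map (f i) :=
    Measure.infinitePi_map_pi (μ := fun _ : ι => μ) (f := f) hf
  have hmeas : Measurable (fun (x : ι → α) (i : ι) => f i (x i)) :=
    measurable_pi_lambda _ fun i => (hf i).comp (measurable_pi_apply i)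
  rw [h1, ← Measure.map_map hmeas (MeasurableEquiv.measurable _), h2, h3]
  congr 1
  funext i
  exact hμ i

end Summit.CriticalPhenomena.CardyFormulaZ2.Theorems
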